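import Summits.QuantumFields.YangMills.Theorems.BalabanUVNodesN15KingModelBlockSpinTransformation

/-!
# BalabanUVNodes ∕ N15 — THE KING-MODEL RUNG (PART Ϻ-ii): THE MASSLESS FIXED POINT IS CRITICAL — the susceptibility `χ(m²) = Σ_zS₂^{ℝ}_{m²}(z) = m⁻²` diverges as `m ↓ 0`, and the massless
# two-point function is NOT summable, `Σ_zS₂^{0}(z) = ∞`, by a renormalisation-group argument: summing the fixed-point identity `Σ_{a,b}S₂^{0}(Lz+a−b) = L^{d+3}S₂^{0}(z)` over the block
# decomposition `ℤ^{d+1} = Lℤ^{d+1} + [0,L)^{d+1}` would give `L^{d+1}χ⁰ = L^{d+3}χ⁰` (Track A, DAG node N15 = NE2; FAN-OUT v1.1 §N15 s3 «KING-MODEL RUNG»; count-neutral)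

HONEST FRAMING.  Count-neutral (cell `pub-ymgap`, seat `pub-ymgap-dag-n15-e` g36; `--supports stmt-QuantumFields-27366 --as helper` = K3⁸).  King's `A = 0`, `g = 0` model
([King1986] C. King, Commun. Math. Phys. **102** (1986) 649–677).  Part Ϝ-k's sum rule `Σ_zS₂^{ℝ}_{m²}(z) = m⁻²` says the susceptibility of King's block field is `χ(m²) = m⁻²`
(mean-field exponent `γ = 1` in `m²`): ★ `χ(m²) → ∞` as `m² ↓ 0`.  At the fixed point the susceptibility is INFINITE: ★★★ **`¬ Summable S₂^{0}`** (`d + 1 ≥ 3`).  The proof is pure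
renormalisation group: the block map `(z, a) ↦ Lz + a` is a BIJECTION `ℤ^{d+1} × [0,L)^{d+1} → ℤ^{d+1}` (coordinatewise Euclidean division, Mathlib's `Int.divModEquiv`), so for a summable
`f`, `Σ_wf(w) = Σ_zΣ_af(Lz + a − c)` for each offset `c`; summing part Ϻ-cc's fixed-point identity over `z` would give `L^{d+1}χ⁰ = L^{d+3}χ⁰` with `χ⁰ > 0` — absurd for `L = 2`.
NOT Bałaban's objects; NOT a node discharge; nothing continuum-Yang–Mills ∕ `ℝ⁴` ∕ OS ∕ Clay.  0 `sorry`, 0 def; standard axioms.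

WHAT THIS FILE PROVES (kernel).  ★ `tendsto_susceptibility_mass_zero`, `blockSite_eq_divModEquiv_symm`, ★ `blockSite_bijective`, `tsum_eq_tsum_blockSite`, `summable_blockSite`, `tsum_prod_eq_tsum_sum`,
`summable_sum_of_summable_prod`, ★ `tsum_blockDecomposition` (`Σ_wf(w) = Σ_zΣ_{a∈[0,L)^{d+1}}f(Lz + a − c)`),
`summable_blockDecomposition`, `blockSite_sub_eq`, ★★★ **`not_summable_kingS2Inf0`**, ★★ `tendsto_sum_kingS2Inf0_atTop` (the partial sums over any exhausting sequence of finite sets diverge).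

HONEST SCOPE.  King's free block fields at infinite volume, `d + 1 ≥ 3` for the massless statements.  N15 untouched; counts unmoved.
Locators (use): [King1986] Thm 2.1 (2.22)–(2.23) p.654, (4.8) p.671, §2 (2.3)–(2.6) p.652.
-/

noncomputable section

open scoped BigOperators Topology
open Filter MeasureTheory Finset

namespace Summit.QuantumFields.YangMills.BalabanUVNodes.N15KingModelRung.InfiniteVolume

open Summit.QuantumFields.YangMills.BalabanUVNodes.N15KingModelRung.OptimalDecay
open Summit.QuantumFields.YangMills.BalabanUVNodes.N15KingModelRung.ProperTime

variable {d : ℕ}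

/-- ★ **THE SUSCEPTIBILITY DIVERGES AT THE CRITICAL POINT**: `χ(m²) = Σ_zS₂^{ℝ}_{m²}(z) = m⁻² → ∞` as `m² ↓ 0`. [cite: King1986, Thm 2.1 (2.23) p.654, (4.8) p.671] -/
theorem tendsto_susceptibility_mass_zero : Tendsto (fun m2 : ℝ => ∑' z : Fin (d + 1) → ℤ, kingS2Inf m2 z) (𝓝[>] 0) atTop := by
  have hev : (fun m2 : ℝ => m2⁻¹) =ᶠ[𝓝[>] 0] fun m2 : ℝ => ∑' z : Fin (d + 1) → ℤ, kingS2Inf m2 z :=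
    eventually_nhdsWithin_of_forall fun m2 hm2 => (tsum_kingS2Inf_eq_inv_mass (d := d) hm2).symm
  exact Tendsto.congr' hev tendsto_inv_nhdsGT_zero

/-- The block site `Lz + a` read coordinatewise through Mathlib's Euclidean-division equivalence `ℤ ≃ ℤ × Fin L`. [folklore] -/
theorem blockSite_eq_divModEquiv_symm (L : ℕ) [NeZero L] (z : Fin (d + 1) → ℤ) (a : Fin (d + 1) → Fin L) (μ : Fin (d + 1)) :
    blockSite L z a μ = (Int.divModEquiv L).symm (z μ, a μ) := by
  rw [Int.divModEquiv_symm_apply]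
  simp only [blockSite]
  ring

/-- ★ **THE BLOCK MAP IS A BIJECTION** `ℤ^{d+1} × [0,L)^{d+1} → ℤ^{d+1}`, `(z, a) ↦ Lz + a` (`L ≥ 1`): every site lies in exactly one `L`-block, at exactly one inner position. [cite: King1986, §2 (2.3) p.652] -/
theorem blockSite_bijective (L : ℕ) [NeZero L] :
    Function.Bijective fun p : (Fin (d + 1) → ℤ) × (Fin (d + 1) → Fin L) => blockSite L p.1 p.2 := by
  constructor
  · rintro ⟨z, a⟩ ⟨z', a'⟩ h
    have hμ : ∀ μ, (z μ, a μ) = (z' μ, a' μ) := fun μ => by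
      apply (Int.divModEquiv L).symm.injective
      rw [← blockSite_eq_divModEquiv_symm, ← blockSite_eq_divModEquiv_symm]
      exact congr_fun h μ
    exact Prod.ext (funext fun μ => (Prod.mk.inj (hμ μ)).1) (funext fun μ => (Prod.mk.inj (hμ μ)).2)
  · intro w
    refine ⟨(fun μ => ((Int.divModEquiv L) (w μ)).1, fun μ => ((Int.divModEquiv L) (w μ)).2), ?_⟩
    funext μ
    show blockSite L (fun μ => ((Int.divModEquiv L) (w μ)).1) (fun μ => ((Int.divModEquiv L) (w μ)).2) μ = w μ
    rw [blockSite_eq_divModEquiv_symm, Prod.mk.eta, Equiv.symm_apply_apply]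

/-- Re-indexing a lattice sum by blocks: `Σ_wg(w) = Σ_{(z,a)}g(Lz + a)`. [folklore] -/
theorem tsum_eq_tsum_blockSite (g : (Fin (d + 1) → ℤ) → ℝ) (L : ℕ) [NeZero L] :
    ∑' w : Fin (d + 1) → ℤ, g w = ∑' p : (Fin (d + 1) → ℤ) × (Fin (d + 1) → Fin L), g (blockSite L p.1 p.2) :=
  ((Equiv.ofBijective _ (blockSite_bijective (d := d) L)).tsum_eq g).symm

/-- Summability transported along the block bijection. [folklore] -/
theorem summable_blockSite {g : (Fin (d + 1) → ℤ) → ℝ} (hg : Summable g) (L : ℕ) [NeZero L] :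
    Summable fun p : (Fin (d + 1) → ℤ) × (Fin (d + 1) → Fin L) => g (blockSite L p.1 p.2) :=
  (Equiv.ofBijective _ (blockSite_bijective (d := d) L)).summable_iff.mpr hg

/-- A summable function on `ℤ^{d+1} × [0,L)^{d+1}` summed first over the finite inner index. [folklore] -/
theorem tsum_prod_eq_tsum_sum (L : ℕ) {h : (Fin (d + 1) → ℤ) × (Fin (d + 1) → Fin L) → ℝ} (hh : Summable h) :
    ∑' p, h p = ∑' z : Fin (d + 1) → ℤ, ∑ a : Fin (d + 1) → Fin L, h (z, a) := by
  rw [hh.tsum_prod]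
  refine tsum_congr fun z => ?_
  rw [tsum_fintype]

/-- … and the inner finite sums are summable in the outer index. [folklore] -/
theorem summable_sum_of_summable_prod (L : ℕ) {h : (Fin (d + 1) → ℤ) × (Fin (d + 1) → Fin L) → ℝ} (hh : Summable h) :
    Summable fun z : Fin (d + 1) → ℤ => ∑ a : Fin (d + 1) → Fin L, h (z, a) := by
  refine hh.prod.congr fun z => ?_
  rw [tsum_fintype]

/-- ★ **THE BLOCK DECOMPOSITION OF LATTICE SUMS**: for summable `f` on `ℤ^{d+1}`, `L ≥ 1` and any offset `c`, `Σ_wf(w) = Σ_zΣ_{a∈[0,L)^{d+1}}f(Lz + a − c)`. [folklore] -/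
theorem tsum_blockDecomposition {f : (Fin (d + 1) → ℤ) → ℝ} (hf : Summable f) (L : ℕ) [NeZero L] (c : Fin (d + 1) → ℤ) :
    ∑' w : Fin (d + 1) → ℤ, f w = ∑' z : Fin (d + 1) → ℤ, ∑ a : Fin (d + 1) → Fin L, f (blockSite L z a - c) := by
  have hSc : Summable fun w : Fin (d + 1) → ℤ => f (w - c) := (Equiv.subRight c).summable_iff.mpr hf
  calc ∑' w : Fin (d + 1) → ℤ, f w = ∑' w : Fin (d + 1) → ℤ, f (w - c) := ((Equiv.subRight c).tsum_eq f).symm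
    _ = ∑' p : (Fin (d + 1) → ℤ) × (Fin (d + 1) → Fin L), f (blockSite L p.1 p.2 - c) := tsum_eq_tsum_blockSite (fun w => f (w - c)) L
    _ = ∑' z : Fin (d + 1) → ℤ, ∑ a : Fin (d + 1) → Fin L, f (blockSite L z a - c) :=
        tsum_prod_eq_tsum_sum L (h := fun p => f (blockSite L p.1 p.2 - c)) (summable_blockSite hSc L)

/-- Under the block decomposition the inner block sums are summable in the block label `z`. [folklore] -/
theorem summable_blockDecomposition {f : (Fin (d + 1) → ℤ) → ℝ} (hf : Summable f) (L : ℕ) [NeZero L] (c : Fin (d + 1) → ℤ) :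
    Summable fun z : Fin (d + 1) → ℤ => ∑ a : Fin (d + 1) → Fin L, f (blockSite L z a - c) :=
  summable_sum_of_summable_prod L (h := fun p => f (blockSite L p.1 p.2 - c)) (summable_blockSite ((Equiv.subRight c).summable_iff.mpr hf) L)

/-- `Lz + a − b` (the argument of the fixed-point identity) is the block site shifted by the offset `b`. [folklore] -/
theorem blockSite_sub_eq (L : ℕ) (z : Fin (d + 1) → ℤ) (a b : Fin (d + 1) → Fin L) :
    blockSite L z a - (fun μ => ((b μ : ℕ) : ℤ)) = fun μ => (L : ℤ) * z μ + ((a μ : ℕ) : ℤ) - ((b μ : ℕ) : ℤ) := by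
  funext μ
  simp only [blockSite, Pi.sub_apply]

/-- ★★★ **THE MASSLESS TWO-POINT FUNCTION IS NOT SUMMABLE — INFINITE SUSCEPTIBILITY AT THE FIXED POINT** (`d + 1 ≥ 3`): `Σ_{z∈ℤ^{d+1}}S₂^{0}(z) = ∞`.  Renormalisation-group proof: were it summable with
sum `χ⁰ > 0`, summing the fixed-point identity `Σ_{a,b∈[0,2)^{d+1}}S₂^{0}(2z+a−b) = 2^{d+3}S₂^{0}(z)` over `z` through the block decomposition would give `2^{d+1}χ⁰ = 2^{d+3}χ⁰`.
[cite: King1986, Thm 2.1 (2.22) p.654, §2 (2.3)–(2.6) p.652] -/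
theorem not_summable_kingS2Inf0 (hd : 2 ≤ d) : ¬ Summable (fun z : Fin (d + 1) → ℤ => kingS2Inf0 z) := by
  intro hS
  classical
  have hχpos : 0 < ∑' z : Fin (d + 1) → ℤ, kingS2Inf0 z := hS.tsum_pos (fun z => (kingS2Inf0_pos hd z).le) 0 (kingS2Inf0_pos hd 0)
  -- the fixed-point identity for `L = 2`, in block-site form
  have hfix : ∀ z : Fin (d + 1) → ℤ, ∑ a : Fin (d + 1) → Fin 2, ∑ b : Fin (d + 1) → Fin 2,
      kingS2Inf0 (blockSite 2 z a - fun μ => ((b μ : ℕ) : ℤ)) = ((2 : ℕ) : ℝ) ^ (d + 3) * kingS2Inf0 z := by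
    intro z
    simp_rw [blockSite_sub_eq]
    exact kingS2Inf0_rg_fixed_point hd (by norm_num : 1 ≤ 2) z
  have hsumb : ∀ b : Fin (d + 1) → Fin 2, Summable fun z : Fin (d + 1) → ℤ =>
      ∑ a : Fin (d + 1) → Fin 2, kingS2Inf0 (blockSite 2 z a - fun μ => ((b μ : ℕ) : ℤ)) :=
    fun b => summable_blockDecomposition hS 2 _
  have hb : ∀ b : Fin (d + 1) → Fin 2, ∑' z : Fin (d + 1) → ℤ,
      ∑ a : Fin (d + 1) → Fin 2, kingS2Inf0 (blockSite 2 z a - fun μ => ((b μ : ℕ) : ℤ)) = ∑' z : Fin (d + 1) → ℤ, kingS2Inf0 z :=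
    fun b => (tsum_blockDecomposition hS 2 _).symm
  -- left side: `Σ_b χ⁰ = 2^{d+1}χ⁰`
  have hleft : ∑ b : Fin (d + 1) → Fin 2, ∑' z : Fin (d + 1) → ℤ,
      ∑ a : Fin (d + 1) → Fin 2, kingS2Inf0 (blockSite 2 z a - fun μ => ((b μ : ℕ) : ℤ)) = ((2 : ℕ) : ℝ) ^ (d + 1) * ∑' z : Fin (d + 1) → ℤ, kingS2Inf0 z := by
    rw [Finset.sum_congr rfl fun b _ => hb b, Finset.sum_const, Finset.card_univ, Fintype.card_fun, Fintype.card_fin, Fintype.card_fin,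
      nsmul_eq_mul]
    push_cast
    ring
  -- right side: the same sum with the finite sums inside is `2^{d+3}χ⁰`
  have hright : ∑ b : Fin (d + 1) → Fin 2, ∑' z : Fin (d + 1) → ℤ,
      ∑ a : Fin (d + 1) → Fin 2, kingS2Inf0 (blockSite 2 z a - fun μ => ((b μ : ℕ) : ℤ)) = ((2 : ℕ) : ℝ) ^ (d + 3) * ∑' z : Fin (d + 1) → ℤ, kingS2Inf0 z := by
    rw [← Summable.tsum_finsetSum fun b _ => hsumb b, ← tsum_mul_left]
    refine tsum_congr fun z => ?_
    rw [Finset.sum_comm]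
    exact hfix z
  have h : ((2 : ℕ) : ℝ) ^ (d + 1) * ∑' z : Fin (d + 1) → ℤ, kingS2Inf0 z = ((2 : ℕ) : ℝ) ^ (d + 3) * ∑' z : Fin (d + 1) → ℤ, kingS2Inf0 z :=
    hleft.symm.trans hright
  have h2 : ((2 : ℕ) : ℝ) ^ (d + 3) = ((2 : ℕ) : ℝ) ^ (d + 1) * 4 := by push_cast; ring
  rw [h2, mul_assoc] at h
  have h4 := mul_left_cancel₀ (pow_ne_zero _ (by norm_num : ((2 : ℕ) : ℝ) ≠ 0)) h
  linarith

/-- ★★ **THE PARTIAL SUMS DIVERGE**: along any sequence of finite sets exhausting `ℤ^{d+1}` (e.g. cubes), `Σ_{z∈s_n}S₂^{0}(z) → ∞` (`d + 1 ≥ 3`; non-negative terms, not summable). [cite: King1986, Thm 2.1 (2.22) p.654] -/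
theorem tendsto_sum_kingS2Inf0_atTop (hd : 2 ≤ d) :
    Tendsto (fun s : Finset (Fin (d + 1) → ℤ) => ∑ z ∈ s, kingS2Inf0 z) atTop atTop := by
  classical
  refine (Finset.sum_mono_set_of_nonneg (f := fun z : Fin (d + 1) → ℤ => kingS2Inf0 z) fun z => (kingS2Inf0_pos hd z).le).tendsto_atTop_atTop
    fun b => ?_
  by_contra h
  push Not at h
  exact not_summable_kingS2Inf0 hd (summable_of_sum_le (fun z => (kingS2Inf0_pos hd z).le) fun u => (h u).le)

end Summit.QuantumFields.YangMills.BalabanUVNodes.N15KingModelRung.InfiniteVolume
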